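import Literature.Analysis.FluidPDE.CKNMorreyRecursion
import Literature.Analysis.FluidPDE.CKNMorreyIteration
import Literature.Analysis.FluidPDE.CKNMorreyCovering
import Literature.Analysis.FluidPDE.CKN1982Setting
import HarnessLib

/-!
# Lemarié-Rieusset 2016, Lemma 13.4 from Lemma 13.3 (Kukavica's Morrey estimates, §13.9 Step 2)

Analysis/FluidPDE file in the decomposition of the named fact
`Literature.Analysis.FluidPDE.lemarieRieusset_ckn_criterion` (Lemarié-Rieusset 2016, Thm. 13.8).
It **proves** the named fact `LemarieRieusset2016.lemma13_4` (`CKNMorreyLemmas.lean`) from the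
named fact `LemarieRieusset2016.lemma13_3` (the local energy and pressure estimates
(13.30)–(13.31), `CKNMorreyLocalEnergy.lean`) and the accepted interpolation inequality
`interpolationEstimate` (Robinson–Rodrigo–Sadowski 2016, Lemma 15.10), following the printed
Step 2 of §13.9 (pp. 471–474) with the corrections recorded in the companion files:

1. at the centre `z₀`, along the scales `κⁿ ρ₀`, the recursions (13.40)–(13.41)
   (`recursion_at`) and the hypothesis `limsup_{r→0} r⁻¹ V_r(z₀) < ε*` feed the abstract iteration
   `iteration_tendsto_zero`, so `αₙ(z₀), qₙ(z₀) → 0` (the book argues with `β_r → 0`; eventual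
   smallness `β_r < ε*` is what is available and suffices);
2. smallness at `z₀` at one scale `ρ_N` spreads to all centres `z ∈ Q_{ρ_N/2}(z₀)` at scale
   `r₁ = ρ_N/2` (`Q_{r₁}(z) ⊆ Q_{ρ_N}(z₀)`);
3. at each such centre the `β`-free recursions (13.45)–(13.47) keep `α ≤ 1`, `q ≤ c_*` and bound
   `p` down the scales `κⁿ r₁` (`invariant_region`);
4. these bounds at discrete scales give the three Morrey conditions on `Q₂ = Q_{r₁}(z₀)`
   (`isParabolicMorreyOn_cylinder_of_discrete`), using `W_r ≤ C r^{1/2}(U_r + V_r)^{3/2}`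
   (`cubicW_le_of_interpolationEstimate`) for the velocity.

The constant: `κ` with `C κ^λ ≤ 1/4`, `C_κ = (C + 1) κ⁻⁴`, `δ₀ = δ₀(q₀, C_κ)` from the
iteration, and `ε* = min((δ₀/C_κ)², (δ₀/C_κ)^{2/q₀})` — a function of `(ν, q₀, τ₀, τ₂)` through the
constant `C(ν, q₀)` of Lemma 13.3 only, as printed.

## References

* P. G. Lemarié-Rieusset, *The Navier–Stokes Problem in the 21st Century*, CRC Press (2016),
  §13.9, Step 2 (proof of Lemma 13.4), pp. 471–474, and Step 3, first paragraph (p. 474).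
  [LemarieRieusset2016]
-/

noncomputable section

open MeasureTheory Set Function Filter Topology TopologicalSpace Metric
open scoped NNReal ENNReal InnerProductSpace RealInnerProductSpace Laplacian

namespace Literature.Analysis.FluidPDE

/-- Local notation for physical space `ℝ³ = EuclideanSpace ℝ (Fin 3)`. -/
local notation "ℝ³" => EuclideanSpace ℝ (Fin 3)

namespace LemarieRieusset2016

/-! ### Small real-variable helpers -/

/-- A radius threshold: for `A ≥ 0`, `e > 0`, `t > 0` there is `ρ₁ > 0` with `A ρ^e ≤ t` for all
`0 < ρ ≤ ρ₁` (p. 473: "there exists `ρ₀ = ρ₀(κ, τ₀, τ₂, f)` such that …"). [folklore] -/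
theorem exists_rpow_threshold {A e t : ℝ} (hA : 0 ≤ A) (he : 0 < e) (ht : 0 < t) :
    ∃ ρ₁ : ℝ, 0 < ρ₁ ∧ ∀ ρ, 0 < ρ → ρ ≤ ρ₁ → A * ρ ^ e ≤ t := by
  refine ⟨(t / (A + 1)) ^ (1 / e), by positivity, fun ρ hρ hρ₁ => ?_⟩
  have h1 : ρ ^ e ≤ t / (A + 1) := by
    calc ρ ^ e ≤ ((t / (A + 1)) ^ (1 / e)) ^ e := Real.rpow_le_rpow hρ.le hρ₁ he.le
      _ = t / (A + 1) := by
          rw [← Real.rpow_mul (by positivity), one_div_mul_cancel he.ne', Real.rpow_one]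
  calc A * ρ ^ e ≤ A * (t / (A + 1)) := mul_le_mul_of_nonneg_left h1 hA
    _ ≤ t := by
        rw [mul_div_assoc', div_le_iff₀ (by positivity)]
        nlinarith

/-- The ratio of scales: for `C ≥ 0` and `λ > 0` there is `κ ∈ (0, 1/2]` with `C κ^λ ≤ 1/4`
(p. 472: "we fix `κ ∈ (0, 1/2)` such that `C₀ κ^λ ≤ 1/4`"). [folklore] -/
theorem exists_kappa {C lam : ℝ} (hC : 0 ≤ C) (hlam : 0 < lam) :
    ∃ κ : ℝ, 0 < κ ∧ κ ≤ 1 / 2 ∧ C * κ ^ lam ≤ 1 / 4 := by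
  refine ⟨min (1 / 2) ((1 / (4 * (C + 1))) ^ (1 / lam)), by positivity, min_le_left _ _, ?_⟩
  have hκ0 : 0 < min (1 / 2) ((1 / (4 * (C + 1))) ^ (1 / lam)) := by positivity
  have h1 : (min (1 / 2) ((1 / (4 * (C + 1))) ^ (1 / lam))) ^ lam ≤ 1 / (4 * (C + 1)) := by
    calc (min (1 / 2) ((1 / (4 * (C + 1))) ^ (1 / lam))) ^ lam
        ≤ ((1 / (4 * (C + 1))) ^ (1 / lam)) ^ lam :=
          Real.rpow_le_rpow hκ0.le (min_le_right _ _) hlam.le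
      _ = 1 / (4 * (C + 1)) := by
          rw [← Real.rpow_mul (by positivity), one_div_mul_cancel hlam.ne', Real.rpow_one]
  calc C * (min (1 / 2) ((1 / (4 * (C + 1))) ^ (1 / lam))) ^ lam ≤ C * (1 / (4 * (C + 1))) :=
        mul_le_mul_of_nonneg_left h1 hC
    _ ≤ 1 / 4 := by
        rw [mul_one_div, div_le_iff₀ (by positivity)]
        nlinarith

/-! ### Spreading: quantities at `z ∈ Q_r(z₀)` against quantities at `z₀` with radius `2r` -/

/-- `Q_r(z) ⊆ Q_{2r}(z₀)` when `z ∈ Q_r(z₀)` (the membership relation is symmetric). [folklore] -/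
theorem cylinder_subset_double_of_mem {X : Type*} [PseudoMetricSpace X] {r : ℝ} {z z₀ : ℝ × X}
    (hz : z ∈ FluidPDE.parabolicCylinderCentered r z₀) :
    FluidPDE.parabolicCylinderCentered r z ⊆ FluidPDE.parabolicCylinderCentered (2 * r) z₀ := by
  refine parabolicCylinderCentered_subset_double ?_
  rw [FluidPDE.mem_parabolicCylinderCentered] at hz ⊢
  obtain ⟨⟨h1, h2⟩, h3⟩ := hz
  rw [dist_comm] at h3
  exact ⟨⟨by linarith, by linarith⟩, h3⟩

/-- `U_r(z) ≤ U_{2r}(z₀)` for `z ∈ Q_r(z₀)` (smaller time interval, smaller balls). [folklore] -/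
theorem energyU_le_double {u : ℝ → ℝ³ → ℝ³} {r : ℝ} {z z₀ : ℝ × ℝ³}
    (hz : z ∈ FluidPDE.parabolicCylinderCentered r z₀) : energyU u r z ≤ energyU u (2 * r) z₀ := by
  rw [FluidPDE.mem_parabolicCylinderCentered] at hz
  obtain ⟨⟨h1, h2⟩, h3⟩ := hz
  have hr : 0 < r := lt_of_le_of_lt dist_nonneg h3
  have hI : Ioo (z.1 - r ^ 2) (z.1 + r ^ 2) ⊆ Ioo (z₀.1 - (2 * r) ^ 2) (z₀.1 + (2 * r) ^ 2) :=
    fun s hs => ⟨by nlinarith [hs.1], by nlinarith [hs.2]⟩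
  have hB : ball z.2 r ⊆ ball z₀.2 (2 * r) := fun y hy => by
    rw [mem_ball] at hy ⊢
    linarith [dist_triangle y z.2 z₀.2]
  rw [energyU, energyU]
  calc essSup (fun s => ∫⁻ y in ball z.2 r, ‖u s y‖ₑ ^ 2)
        (volume.restrict (Ioo (z.1 - r ^ 2) (z.1 + r ^ 2)))
      ≤ essSup (fun s => ∫⁻ y in ball z₀.2 (2 * r), ‖u s y‖ₑ ^ 2)
          (volume.restrict (Ioo (z.1 - r ^ 2) (z.1 + r ^ 2))) :=
        essSup_mono_ae (Eventually.of_forall fun s => lintegral_mono_set hB)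
    _ ≤ essSup (fun s => ∫⁻ y in ball z₀.2 (2 * r), ‖u s y‖ₑ ^ 2)
          (volume.restrict (Ioo (z₀.1 - (2 * r) ^ 2) (z₀.1 + (2 * r) ^ 2))) :=
        essSup_mono_measure' (Measure.restrict_mono hI le_rfl)

/-- `α_r(z) ≤ 2^{3 - 10/τ₂} α_{2r}(z₀)` for `z ∈ Q_r(z₀)` when the quantities at `(2r, z₀)` are
finite. [folklore] -/
theorem alphaR_le_double {u : ℝ → ℝ³ → ℝ³} {G : ℝ → ℝ³ → ℝ³ →L[ℝ] ℝ³} {τ₂ r : ℝ} {z z₀ : ℝ × ℝ³}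
    (hz : z ∈ FluidPDE.parabolicCylinderCentered r z₀) (hU : energyU u (2 * r) z₀ ≠ ∞)
    (hV : gradV G (2 * r) z₀ ≠ ∞) :
    alphaR u G τ₂ r z ≤ (2 : ℝ) ^ (3 - 10 / τ₂) * alphaR u G τ₂ (2 * r) z₀ := by
  have hr : 0 < r := by
    rw [FluidPDE.mem_parabolicCylinderCentered] at hz
    exact lt_of_le_of_lt dist_nonneg hz.2
  have hU' : (energyU u r z).toReal ≤ (energyU u (2 * r) z₀).toReal :=
    ENNReal.toReal_mono hU (energyU_le_double hz)
  have hV' : (gradV G r z).toReal ≤ (gradV G (2 * r) z₀).toReal :=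
    ENNReal.toReal_mono hV (lintegral_mono_set (cylinder_subset_double_of_mem hz))
  rw [alphaR, alphaR, Real.mul_rpow (by norm_num) hr.le, mul_div_assoc',
    mul_div_mul_left _ _ (Real.rpow_pos_of_pos (by norm_num : (0:ℝ) < 2) _).ne']
  exact div_le_div_of_nonneg_right (add_le_add hU' hV') (Real.rpow_nonneg hr.le _)

/-- `r^c p_r(z) ≤ 2^{b-c} (2r)^c p_{2r}(z₀)` for `z ∈ Q_r(z₀)` (`b = 5(1 - 2q₀/τ₂)`, any `c`), when
`P_{2r}(z₀) < ∞`. [folklore] -/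
theorem rpow_mul_pR_le_double {p : ℝ → ℝ³ → ℝ} {q₀ τ₂ c r : ℝ} {z z₀ : ℝ × ℝ³}
    (hz : z ∈ FluidPDE.parabolicCylinderCentered r z₀) (hP : pressureP p q₀ (2 * r) z₀ ≠ ∞) :
    r ^ c * pR p q₀ τ₂ r z ≤
      (2 : ℝ) ^ (5 * (1 - 2 * q₀ / τ₂) - c) * ((2 * r) ^ c * pR p q₀ τ₂ (2 * r) z₀) := by
  have hr : 0 < r := by
    rw [FluidPDE.mem_parabolicCylinderCentered] at hz
    exact lt_of_le_of_lt dist_nonneg hz.2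
  have hP' : (pressureP p q₀ r z).toReal ≤ (pressureP p q₀ (2 * r) z₀).toReal :=
    ENNReal.toReal_mono hP (lintegral_mono_set (cylinder_subset_double_of_mem hz))
  set b : ℝ := 5 * (1 - 2 * q₀ / τ₂)
  have hcoef : (2 : ℝ) ^ (b - c) * ((2 * r) ^ c / (2 * r) ^ b) = r ^ c / r ^ b := by
    rw [← Real.exp_log hr, ← Real.exp_log (by norm_num : (0:ℝ) < 2)]
    simp only [← Real.exp_mul, ← Real.exp_add, div_eq_mul_inv, ← Real.exp_neg]
    congr 1; ring
  rw [pR, pR]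
  calc r ^ c * ((pressureP p q₀ r z).toReal / r ^ b) = r ^ c / r ^ b * (pressureP p q₀ r z).toReal := by
        ring
    _ ≤ r ^ c / r ^ b * (pressureP p q₀ (2 * r) z₀).toReal :=
        mul_le_mul_of_nonneg_left hP' (by positivity)
    _ = (2 : ℝ) ^ (b - c) * ((2 * r) ^ c * ((pressureP p q₀ (2 * r) z₀).toReal / (2 * r) ^ b)) := by
        rw [← hcoef]; ring

/-- `p_r(z) ≤ 2^b p_{2r}(z₀)` for `z ∈ Q_r(z₀)` (`b = 5(1 - 2q₀/τ₂)`), when `P_{2r}(z₀) < ∞`. [folklore] -/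
theorem pR_le_double {p : ℝ → ℝ³ → ℝ} {q₀ τ₂ r : ℝ} {z z₀ : ℝ × ℝ³}
    (hz : z ∈ FluidPDE.parabolicCylinderCentered r z₀) (hP : pressureP p q₀ (2 * r) z₀ ≠ ∞) :
    pR p q₀ τ₂ r z ≤ (2 : ℝ) ^ (5 * (1 - 2 * q₀ / τ₂)) * pR p q₀ τ₂ (2 * r) z₀ := by
  have hr : 0 < r := by
    rw [FluidPDE.mem_parabolicCylinderCentered] at hz
    exact lt_of_le_of_lt dist_nonneg hz.2
  have := rpow_mul_pR_le_double (q₀ := q₀) (τ₂ := τ₂) (c := 0) hz hP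
  simp only [Real.rpow_zero, one_mul, sub_zero] at this
  exact this

/-! ### The local integral bounds behind the Morrey conditions -/

/-- At a centre `z` and scale `ρ` with `Q_{2ρ}(z) ⊆ Ω` and `α_ρ(z) ≤ 1`: `W_ρ(z) ≤ C_W ρ^{5(1-3/τ₂)}`
(`W_ρ ≤ C_W ρ^{1/2}(U_ρ + V_ρ)^{3/2}` and `U_ρ + V_ρ = ρ^{3-10/τ₂} α_ρ ≤ ρ^{3-10/τ₂}`; p. 471). [folklore] -/
theorem cubicW_le_of_alphaR_le_one {u : ℝ → ℝ³ → ℝ³} {G : ℝ → ℝ³ → ℝ³ →L[ℝ] ℝ³} {τ₂ ρ : ℝ}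
    {z : ℝ × ℝ³} {CW : ℝ≥0}
    (hCW : ∀ (u : ℝ → ℝ³ → ℝ³) (G : ℝ → ℝ³ → ℝ³ →L[ℝ] ℝ³) (z : ℝ × ℝ³) (ρ : ℝ), 0 < ρ →
      FluidPDE.HasWeakSpatialGradientOn (FluidPDE.parabolicCylinderCenteredOpens (2 * ρ) z) u G →
      cubicW u ρ z ≤ CW * ENNReal.ofReal (ρ ^ (1 / 2 : ℝ)) * (energyU u ρ z + gradV G ρ z) ^ (3 / 2 : ℝ))
    (hρ : 0 < ρ)
    (hG : FluidPDE.HasWeakSpatialGradientOn (FluidPDE.parabolicCylinderCenteredOpens (2 * ρ) z) u G)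
    (hU : energyU u ρ z ≠ ∞) (hV : gradV G ρ z ≠ ∞) (hα : alphaR u G τ₂ ρ z ≤ 1) :
    cubicW u ρ z ≤ CW * ENNReal.ofReal (ρ ^ (5 * (1 - 3 / τ₂))) := by
  have hsum : energyU u ρ z + gradV G ρ z ≤ ENNReal.ofReal (ρ ^ (3 - 10 / τ₂)) := by
    have hfin : energyU u ρ z + gradV G ρ z ≠ ∞ := ENNReal.add_ne_top.2 ⟨hU, hV⟩
    rw [← ENNReal.ofReal_toReal hfin, ENNReal.toReal_add hU hV]
    refine ENNReal.ofReal_le_ofReal ?_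
    have hρa : 0 < ρ ^ (3 - 10 / τ₂) := Real.rpow_pos_of_pos hρ _
    have := hα
    rw [alphaR, div_le_one hρa] at this
    exact this
  calc cubicW u ρ z ≤ CW * ENNReal.ofReal (ρ ^ (1 / 2 : ℝ)) * (energyU u ρ z + gradV G ρ z) ^ (3 / 2 : ℝ) :=
        hCW u G z ρ hρ hG
    _ ≤ CW * ENNReal.ofReal (ρ ^ (1 / 2 : ℝ)) * (ENNReal.ofReal (ρ ^ (3 - 10 / τ₂))) ^ (3 / 2 : ℝ) := by
        gcongr
    _ = CW * ENNReal.ofReal (ρ ^ (5 * (1 - 3 / τ₂))) := by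
        rw [ENNReal.ofReal_rpow_of_nonneg (Real.rpow_nonneg hρ.le _) (by norm_num), mul_assoc,
          ← ENNReal.ofReal_mul (Real.rpow_nonneg hρ.le _), ← Real.rpow_mul hρ.le,
          ← Real.rpow_add hρ]
        congr 3
        ring

/-- At a centre `z` and scale `ρ` with `α_ρ(z) ≤ 1`: `V_ρ(z) ≤ ρ^{3 - 10/τ₂}`, written for the
integrand `|∇ ⊗ u|²` of the Morrey condition with exponent `2` and `τ₃ = (τ₂⁻¹ + 5⁻¹)⁻¹`
(`5(1 - 2/τ₃) = 3 - 10/τ₂`; p. 474). [folklore] -/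
theorem lintegral_gradENorm_le_of_alphaR_le_one {u : ℝ → ℝ³ → ℝ³} {G : ℝ → ℝ³ → ℝ³ →L[ℝ] ℝ³}
    {τ₂ ρ : ℝ} {z : ℝ × ℝ³} (hτ₂ : τ₂ ≠ 0) (hρ : 0 < ρ) (hU : energyU u ρ z ≠ ∞)
    (hV : gradV G ρ z ≠ ∞) (hα : alphaR u G τ₂ ρ z ≤ 1) :
    ∫⁻ w in FluidPDE.parabolicCylinderCentered ρ z, gradENorm G w ^ (2 : ℝ) ≤
      1 * ENNReal.ofReal (ρ ^ (5 * (1 - 2 / (τ₂⁻¹ + 5⁻¹)⁻¹))) := by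
  have hexp : 5 * (1 - 2 / (τ₂⁻¹ + 5⁻¹)⁻¹) = 3 - 10 / τ₂ := by
    field_simp
    ring
  rw [hexp, one_mul]
  have hint : ∫⁻ w in FluidPDE.parabolicCylinderCentered ρ z, gradENorm G w ^ (2 : ℝ) = gradV G ρ z := by
    rw [gradV]
    exact lintegral_congr fun w => gradENorm_rpow_two G w
  rw [hint]
  have hfin : energyU u ρ z + gradV G ρ z ≠ ∞ := ENNReal.add_ne_top.2 ⟨hU, hV⟩
  calc gradV G ρ z ≤ energyU u ρ z + gradV G ρ z := le_add_self
    _ = ENNReal.ofReal ((energyU u ρ z).toReal + (gradV G ρ z).toReal) := by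
        rw [← ENNReal.toReal_add hU hV, ENNReal.ofReal_toReal hfin]
    _ ≤ ENNReal.ofReal (ρ ^ (3 - 10 / τ₂)) := by
        refine ENNReal.ofReal_le_ofReal ?_
        have hρa : 0 < ρ ^ (3 - 10 / τ₂) := Real.rpow_pos_of_pos hρ _
        have := hα
        rw [alphaR, div_le_one hρa] at this
        exact this

/-- At a centre `z` and scale `ρ` with `p_ρ(z) ≤ P*`: `P_ρ(z) ≤ P* ρ^{5(1 - q₀/(τ₂/2))}`
(`5(1 - 2q₀/τ₂)` is the Morrey exponent for `(q₀, τ₂/2)`). [folklore] -/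
theorem pressureP_le_of_pR_le {p : ℝ → ℝ³ → ℝ} {q₀ τ₂ ρ Pstar : ℝ} {z : ℝ × ℝ³} (hρ : 0 < ρ)
    (hP : pressureP p q₀ ρ z ≠ ∞) (hPstar : 0 ≤ Pstar) (hp : pR p q₀ τ₂ ρ z ≤ Pstar) :
    pressureP p q₀ ρ z ≤ ENNReal.ofReal Pstar * ENNReal.ofReal (ρ ^ (5 * (1 - q₀ / (τ₂ / 2)))) := by
  have hexp : 5 * (1 - q₀ / (τ₂ / 2)) = 5 * (1 - 2 * q₀ / τ₂) := by
    rw [div_div_eq_mul_div]; ring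
  rw [hexp, ← ENNReal.ofReal_mul hPstar, ← ENNReal.ofReal_toReal hP]
  refine ENNReal.ofReal_le_ofReal ?_
  have hρb : 0 < ρ ^ (5 * (1 - 2 * q₀ / τ₂)) := Real.rpow_pos_of_pos hρ _
  rw [pR, div_le_iff₀ hρb] at hp
  exact hp

/-! ### Two more bookkeeping lemmas -/

/-- From `r⁻¹ V_r(z) < ε` in `[0, ∞]` to `β_r(z) < ε` for the real reduced quantity. [folklore] -/
theorem betaR_lt_of_ennreal {G : ℝ → ℝ³ → ℝ³ →L[ℝ] ℝ³} {r ε : ℝ} {z : ℝ × ℝ³} (hr : 0 < r)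
    (h : (ENNReal.ofReal r)⁻¹ * gradV G r z < ENNReal.ofReal ε) : betaR G r z < ε := by
  have := ENNReal.toReal_lt_of_lt_ofReal h
  rw [ENNReal.toReal_mul, ENNReal.toReal_inv, ENNReal.toReal_ofReal hr.le] at this
  rw [betaR, div_eq_inv_mul]
  exact this

/-- **Elimination of `β`** (Lemarié-Rieusset 2016, (13.42)–(13.44) ⟹ (13.45)–(13.47), p. 472):
with `β ≤ σ^{a-1} α` (`a = 3 - 10/τ₂`) the recursions (13.40), (13.41), (13.44) at scale `σ` take
the `β`-free form consumed by `invariant_region`: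
`α₁ ≤ ¼α + C_κ σ^{1-5/τ₂} α^{3/2} + C_κ Q^{1/q₀} α^{1/2} + (C_κ M') σ^γ α^{1/2}`,
`q₁ ≤ ¼q + C_κ σ^{c} α^{q₀}` (`c = q₀(1 - 5/τ₂)`; the corrected form of (13.43)) and
`p₁ ≤ ¼p + C_κ α^{q₀}`. [cite: LemarieRieusset2016, §13.9 Step 2 (13.42)–(13.47) p. 472] -/
theorem beta_free {α₁ α β q₁ q p₁ pp Q σ Cκ M' γ q₀ τ₂ : ℝ} (hCκ : 0 ≤ Cκ)
    (hσ : 0 < σ) (hα : 0 ≤ α) (hβ : 0 ≤ β) (hq₀ : 0 < q₀) (hτ₂ : τ₂ ≠ 0)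
    (hβα : β ≤ σ ^ (3 - 10 / τ₂ - 1) * α)
    (h40 : α₁ ≤ α / 4 + Cκ * β ^ (1 / 2 : ℝ) * α + Cκ * Q ^ (1 / q₀) * α ^ (1 / 2 : ℝ) +
      Cκ * M' * σ ^ γ * α ^ (1 / 2 : ℝ))
    (h41 : q₁ ≤ q / 4 + Cκ * α ^ (q₀ / 2) * β ^ (q₀ / 2))
    (h44 : p₁ ≤ pp / 4 + Cκ * σ ^ (5 * q₀ / τ₂ - q₀) * α ^ (q₀ / 2) * β ^ (q₀ / 2)) :
    α₁ ≤ α / 4 + Cκ * σ ^ (1 - 5 / τ₂) * α ^ (3 / 2 : ℝ) + Cκ * Q ^ (1 / q₀) * α ^ (1 / 2 : ℝ) +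
        Cκ * M' * σ ^ γ * α ^ (1 / 2 : ℝ) ∧
      q₁ ≤ q / 4 + Cκ * σ ^ (q₀ * (1 - 5 / τ₂)) * α ^ q₀ ∧
      p₁ ≤ pp / 4 + Cκ * α ^ q₀ := by
  have hσa : 0 ≤ σ ^ (3 - 10 / τ₂ - 1) := Real.rpow_nonneg hσ.le _
  -- `β^{1/2} ≤ σ^{1 - 5/τ₂} α^{1/2}` and `β^{q₀/2} ≤ σ^{c} α^{q₀/2}`
  have hb1 : β ^ (1 / 2 : ℝ) ≤ σ ^ (1 - 5 / τ₂) * α ^ (1 / 2 : ℝ) := by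
    calc β ^ (1 / 2 : ℝ) ≤ (σ ^ (3 - 10 / τ₂ - 1) * α) ^ (1 / 2 : ℝ) :=
          Real.rpow_le_rpow hβ hβα (by norm_num)
      _ = σ ^ (1 - 5 / τ₂) * α ^ (1 / 2 : ℝ) := by
          rw [Real.mul_rpow hσa hα, ← Real.rpow_mul hσ.le]
          congr 2
          field_simp
          ring
  have hb2 : β ^ (q₀ / 2) ≤ σ ^ (q₀ * (1 - 5 / τ₂)) * α ^ (q₀ / 2) := by
    calc β ^ (q₀ / 2) ≤ (σ ^ (3 - 10 / τ₂ - 1) * α) ^ (q₀ / 2) :=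
          Real.rpow_le_rpow hβ hβα (by positivity)
      _ = σ ^ (q₀ * (1 - 5 / τ₂)) * α ^ (q₀ / 2) := by
          rw [Real.mul_rpow hσa hα, ← Real.rpow_mul hσ.le]
          congr 2
          field_simp
          ring
  have hα32 : α ^ (1 / 2 : ℝ) * α = α ^ (3 / 2 : ℝ) := by
    rw [show (3 / 2 : ℝ) = 1 / 2 + 1 by norm_num, Real.rpow_add' hα (by norm_num), Real.rpow_one]
  have hαq : α ^ (q₀ / 2) * α ^ (q₀ / 2) = α ^ q₀ := by
    rw [← Real.rpow_add' hα (by positivity)]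
    congr 1
    ring
  refine ⟨?_, ?_, ?_⟩
  · have h2 : Cκ * β ^ (1 / 2 : ℝ) * α ≤ Cκ * σ ^ (1 - 5 / τ₂) * α ^ (3 / 2 : ℝ) := by
      calc Cκ * β ^ (1 / 2 : ℝ) * α ≤ Cκ * (σ ^ (1 - 5 / τ₂) * α ^ (1 / 2 : ℝ)) * α := by
            gcongr
        _ = Cκ * σ ^ (1 - 5 / τ₂) * α ^ (3 / 2 : ℝ) := by rw [← hα32]; ring
    linarith
  · have h2 : Cκ * α ^ (q₀ / 2) * β ^ (q₀ / 2) ≤ Cκ * σ ^ (q₀ * (1 - 5 / τ₂)) * α ^ q₀ := by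
      calc Cκ * α ^ (q₀ / 2) * β ^ (q₀ / 2)
          ≤ Cκ * α ^ (q₀ / 2) * (σ ^ (q₀ * (1 - 5 / τ₂)) * α ^ (q₀ / 2)) := by
            exact mul_le_mul_of_nonneg_left hb2 (mul_nonneg hCκ (Real.rpow_nonneg hα _))
        _ = Cκ * σ ^ (q₀ * (1 - 5 / τ₂)) * α ^ q₀ := by rw [← hαq]; ring
    linarith
  · have hexp : σ ^ (5 * q₀ / τ₂ - q₀) * σ ^ (q₀ * (1 - 5 / τ₂)) = 1 := by
      rw [← Real.rpow_add hσ]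
      convert Real.rpow_zero σ using 2
      ring
    have h2 : Cκ * σ ^ (5 * q₀ / τ₂ - q₀) * α ^ (q₀ / 2) * β ^ (q₀ / 2) ≤ Cκ * α ^ q₀ := by
      calc Cκ * σ ^ (5 * q₀ / τ₂ - q₀) * α ^ (q₀ / 2) * β ^ (q₀ / 2)
          ≤ Cκ * σ ^ (5 * q₀ / τ₂ - q₀) * α ^ (q₀ / 2) * (σ ^ (q₀ * (1 - 5 / τ₂)) * α ^ (q₀ / 2)) :=
            mul_le_mul_of_nonneg_left hb2 (mul_nonneg (mul_nonneg hCκ (Real.rpow_nonneg hσ.le _))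
              (Real.rpow_nonneg hα _))
        _ = Cκ * (σ ^ (5 * q₀ / τ₂ - q₀) * σ ^ (q₀ * (1 - 5 / τ₂))) * (α ^ (q₀ / 2) * α ^ (q₀ / 2)) := by
            ring
        _ = Cκ * α ^ q₀ := by rw [hexp, hαq, mul_one]
    linarith

/-! ### Lemma 13.4 from Lemma 13.3 and the interpolation inequality -/

-- The assembly below chains four stages with many intermediate quantities; give it room.
set_option maxHeartbeats 4000000 in
/-- **Lemma 13.4 follows from Lemma 13.3 and the interpolation inequality** (Lemarié-Rieusset
2016, §13.9, Step 2, pp. 471–474, made explicit: `recursion_at` + `iteration_tendsto_zero` at the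
centre, spreading to `Q_{ρ_N/2}(z₀)`, `invariant_region` at every centre there, and
`isParabolicMorreyOn_cylinder_of_discrete` for the three Morrey conditions; the velocity bound
uses `W_r ≤ C_W r^{1/2} (U_r + V_r)^{3/2}` from the accepted `interpolationEstimate`). [cite: LemarieRieusset2016, §13.9 Step 2 pp. 471–474] -/
theorem lemma13_4_of (h3 : lemma13_3) (hI : interpolationEstimate) : lemma13_4 := by
  intro ν q₀ τ₀ τ₂ hν hq₀ hq₀' hτ₀' hτ₂a hτ₂b hgap
  -- exponents
  have hq₀0 : 0 < q₀ := by linarith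
  have hτ₀ : 0 < τ₀ := by linarith
  have h5τ₂ : 5 < τ₂ := by
    by_contra h
    push Not at h
    have : τ₂ / 5 ≤ 1 := by rw [div_le_one (by norm_num : (0:ℝ) < 5)]; exact h
    linarith
  have hτ₂0 : 0 < τ₂ := by linarith
  have hτ₂q : τ₂ < 5 * q₀ := by
    have h1 : τ₂ / 5 < q₀ := lt_of_lt_of_le hτ₂b (min_le_left _ _)
    rwa [div_lt_iff₀ (by norm_num : (0:ℝ) < 5), mul_comm] at h1
  have h10τ₂ : 10 / τ₂ < 2 := by rw [div_lt_iff₀ hτ₂0]; linarith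
  have h10τ₂0 : 0 < 10 / τ₂ := by positivity
  have h10q : 2 < 10 * q₀ / τ₂ := by rw [lt_div_iff₀ hτ₂0]; linarith
  have h5q : 5 * q₀ / τ₂ < q₀ := by rw [div_lt_iff₀ hτ₂0]; nlinarith
  have h5q0 : 0 < 5 * q₀ / τ₂ := by positivity
  have h10qle : 10 * q₀ / τ₂ ≤ 3 := by rw [div_le_iff₀ hτ₂0]; nlinarith
  set a : ℝ := 3 - 10 / τ₂ with ha
  set b : ℝ := 5 * (1 - 2 * q₀ / τ₂) with hb
  set c : ℝ := q₀ * (1 - 5 / τ₂) with hc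
  set γ : ℝ := 2 - 5 / τ₀ + 5 / τ₂ with hγ
  set lam : ℝ := min (10 / τ₂) (10 * q₀ / τ₂ - 2) with hlam
  have ha1 : 1 < a := by rw [ha]; linarith
  have ha3 : a ≤ 3 := by rw [ha]; linarith
  have hb' : b = 5 - 10 * q₀ / τ₂ := by rw [hb]; ring
  have hc' : c = q₀ - 5 * q₀ / τ₂ := by rw [hc]; ring
  have hc0 : 0 < c := by rw [hc']; linarith
  have hγ0 : 0 < γ := by rw [hγ]; linarith
  have hlam0 : 0 < lam := lt_min h10τ₂0 (by linarith)
  have he1 : 0 < 1 - 5 / τ₂ := by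
    rw [sub_pos, div_lt_one hτ₂0]; linarith
  have hbc4 : b - c ≤ 4 := by rw [hb', hc']; linarith
  have hb5 : b ≤ 5 := by rw [hb']; linarith
  -- constants
  obtain ⟨C, hC⟩ := h3 ν q₀ hν hq₀ hq₀'
  obtain ⟨CW, hCW⟩ := cubicW_le_of_interpolationEstimate hI
  have hC0 : (0 : ℝ) ≤ C := C.coe_nonneg
  obtain ⟨κ, hκ0, hκ, hCκ⟩ := exists_kappa hC0 hlam0
  have hκ1 : κ ≤ 1 := hκ.trans (by norm_num)
  have hκ1' : κ < 1 := lt_of_le_of_lt hκ (by norm_num)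
  set Cκ : ℝ := ((C : ℝ) + 1) * κ ^ (-(4 : ℝ)) with hCκdef
  have hCκpos : 0 < Cκ := mul_pos (by linarith) (Real.rpow_pos_of_pos hκ0 _)
  obtain ⟨δ₀, hδ₀, hiter⟩ :=
    iteration_tendsto_zero (q₀ := q₀) (Cκ := Cκ) hq₀.le (by linarith) hCκpos.le
  have hdC : 0 < δ₀ / Cκ := div_pos hδ₀ hCκpos
  set ε : ℝ := min ((δ₀ / Cκ) ^ (2 : ℝ)) ((δ₀ / Cκ) ^ (2 / q₀)) with hεdef
  have hε : 0 < ε := lt_min (Real.rpow_pos_of_pos hdC _) (Real.rpow_pos_of_pos hdC _)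
  refine ⟨ε, hε, ?_⟩
  intro Ω f u p G hS hMf z₀ hz₀ hlim
  obtain ⟨M, hM⟩ := hMf
  -- the room `Q_{4r₀}(z₀) ⊆ Ω`
  obtain ⟨r₄, hr₄, -, hbox⟩ := exists_closedCylinder_subset Ω.isOpen hz₀
  set r₀ : ℝ := r₄ / 4 with hr₀def
  have hr₀ : 0 < r₀ := by positivity
  have hroom : FluidPDE.parabolicCylinderCentered (4 * r₀) z₀ ⊆ (Ω : Set (ℝ × ℝ³)) := by
    rw [show 4 * r₀ = r₄ by rw [hr₀def]; ring]
    exact (parabolicCylinderCentered_subset_closedCylinder r₄ z₀).trans hbox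
  have hz₀mem : z₀ ∈ FluidPDE.parabolicCylinderCentered r₀ z₀ := self_mem_parabolicCylinderCentered hr₀ z₀
  -- the `limsup` hypothesis: `β_r(z₀) < ε` for `r < r*`
  obtain ⟨rstar, hrstar, hβlt⟩ := exists_forall_lt_of_limsup_le le_rfl hlim
  -- thresholds on the radius
  obtain ⟨ρ₁, hρ₁, hth1⟩ := exists_rpow_threshold (A := Cκ) (t := 1 / 4) hCκpos.le he1 (by norm_num)
  obtain ⟨ρ₂, hρ₂, hth2⟩ := exists_rpow_threshold (A := Cκ * (M : ℝ) ^ (7 / 10 : ℝ)) (t := 1 / 4)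
    (mul_nonneg hCκpos.le (Real.rpow_nonneg M.coe_nonneg _)) hγ0 (by norm_num)
  set cstar : ℝ := (4 * (Cκ + 1)) ^ (-q₀) with hcstar
  have hcstar0 : 0 < cstar := Real.rpow_pos_of_pos (by linarith) _
  obtain ⟨ρ₃, hρ₃, hth3⟩ := exists_rpow_threshold (A := Cκ) (t := 3 / 4 * cstar) hCκpos.le hc0
    (by positivity)
  set ρ₀ : ℝ := min (min r₀ (rstar / 2)) (min ρ₁ (min ρ₂ ρ₃)) with hρ₀def
  have hρ₀ : 0 < ρ₀ := by positivity
  have hρ₀r₀ : ρ₀ ≤ r₀ := (min_le_left _ _).trans (min_le_left _ _)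
  have hρ₀star : ρ₀ < rstar :=
    lt_of_le_of_lt ((min_le_left _ _).trans (min_le_right _ _)) (by linarith)
  have hρ₀1 : ρ₀ ≤ ρ₁ := (min_le_right _ _).trans (min_le_left _ _)
  have hρ₀2 : ρ₀ ≤ ρ₂ := (min_le_right _ _).trans ((min_le_right _ _).trans (min_le_left _ _))
  have hρ₀3 : ρ₀ ≤ ρ₃ := (min_le_right _ _).trans ((min_le_right _ _).trans (min_le_right _ _))
  -- the recursions (13.40), (13.41), (13.44) at admissible centres and scales
  have hrec := fun (z : ℝ × ℝ³) (hz : z ∈ FluidPDE.parabolicCylinderCentered r₀ z₀) (ρ : ℝ)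
      (hρ : 0 < ρ) (hρr₀ : ρ ≤ r₀) =>
    recursion_at hq₀ hq₀' h5τ₂ hτ₂q hτ₀ hC hS hM hr₀ hroom hz hρ hρr₀ hκ0 hκ hCκ
  -- finiteness on cylinders inside the room
  obtain ⟨CE, hCE⟩ := hS.energy
  have hfin : ∀ (z : ℝ × ℝ³), z ∈ FluidPDE.parabolicCylinderCentered r₀ z₀ → ∀ ρ : ℝ, 0 < ρ →
      ρ ≤ r₀ → energyU u ρ z ≠ ∞ ∧ gradV G ρ z ≠ ∞ ∧ pressureP p q₀ ρ z ≠ ∞ := by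
    intro z hz ρ hρ hρr₀
    have hsub : FluidPDE.parabolicCylinderCentered ρ z ⊆ (Ω : Set (ℝ × ℝ³)) :=
      (cylinder_subset_room hz hρ.le (by linarith)).trans hroom
    exact ⟨ne_top_of_le_ne_top ENNReal.coe_ne_top (energyU_le_of_subset hCE hsub),
      (gradV_lt_top_of_subset hS.gradient_sq_lt_top hsub).ne,
      (pressureP_lt_top_of_subset hS.pressure_lt_top hsub).ne⟩
  ---------------------------------------------------------------------------------------------
  -- Stage 1: the iteration at the centre `z₀` along `κⁿ ρ₀`
  ---------------------------------------------------------------------------------------------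
  have hρn0 : ∀ n : ℕ, 0 < κ ^ n * ρ₀ := fun n => by positivity
  have hρnle : ∀ n : ℕ, κ ^ n * ρ₀ ≤ ρ₀ := fun n =>
    mul_le_of_le_one_left hρ₀.le (pow_le_one₀ hκ0.le hκ1)
  have hρnsucc : ∀ n : ℕ, κ * (κ ^ n * ρ₀) = κ ^ (n + 1) * ρ₀ := fun n => by ring
  -- `β < ε` at every scale `κⁿ ρ₀`
  have hβn : ∀ n : ℕ, betaR G (κ ^ n * ρ₀) z₀ < ε := fun n =>
    betaR_lt_of_ennreal (hρn0 n) (hβlt _ (hρn0 n) (lt_of_le_of_lt (hρnle n) hρ₀star))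
  have hβn0 : ∀ n : ℕ, 0 ≤ betaR G (κ ^ n * ρ₀) z₀ := fun n => betaR_nonneg G (hρn0 n).le z₀
  -- the small coefficients `uₙ = C_κ βₙ^{1/2} ≤ δ₀`, `wₙ = C_κ βₙ^{q₀/2} ≤ δ₀`
  have hun : ∀ n : ℕ, Cκ * betaR G (κ ^ n * ρ₀) z₀ ^ (1 / 2 : ℝ) ≤ δ₀ := by
    intro n
    have h1 : betaR G (κ ^ n * ρ₀) z₀ ^ (1 / 2 : ℝ) ≤ δ₀ / Cκ := by
      calc betaR G (κ ^ n * ρ₀) z₀ ^ (1 / 2 : ℝ) ≤ ε ^ (1 / 2 : ℝ) :=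
            Real.rpow_le_rpow (hβn0 n) (hβn n).le (by norm_num)
        _ ≤ ((δ₀ / Cκ) ^ (2 : ℝ)) ^ (1 / 2 : ℝ) :=
            Real.rpow_le_rpow hε.le (min_le_left _ _) (by norm_num)
        _ = δ₀ / Cκ := by rw [← Real.rpow_mul hdC.le]; norm_num
    calc Cκ * betaR G (κ ^ n * ρ₀) z₀ ^ (1 / 2 : ℝ) ≤ Cκ * (δ₀ / Cκ) :=
          mul_le_mul_of_nonneg_left h1 hCκpos.le
      _ = δ₀ := by field_simp
  have hwn : ∀ n : ℕ, Cκ * betaR G (κ ^ n * ρ₀) z₀ ^ (q₀ / 2) ≤ δ₀ := by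
    intro n
    have h1 : betaR G (κ ^ n * ρ₀) z₀ ^ (q₀ / 2) ≤ δ₀ / Cκ := by
      calc betaR G (κ ^ n * ρ₀) z₀ ^ (q₀ / 2) ≤ ε ^ (q₀ / 2) :=
            Real.rpow_le_rpow (hβn0 n) (hβn n).le (by positivity)
        _ ≤ ((δ₀ / Cκ) ^ (2 / q₀)) ^ (q₀ / 2) :=
            Real.rpow_le_rpow hε.le (min_le_right _ _) (by positivity)
        _ = δ₀ / Cκ := by
            rw [← Real.rpow_mul hdC.le, div_mul_div_comm, mul_comm 2 q₀, div_self (by positivity),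
              Real.rpow_one]
    calc Cκ * betaR G (κ ^ n * ρ₀) z₀ ^ (q₀ / 2) ≤ Cκ * (δ₀ / Cκ) :=
          mul_le_mul_of_nonneg_left h1 hCκpos.le
      _ = δ₀ := by field_simp
  -- `vₙ = C_κ M^{7/10} (κⁿρ₀)^γ → 0`
  have hvn : Tendsto (fun n : ℕ => Cκ * (M : ℝ) ^ (7 / 10 : ℝ) * (κ ^ n * ρ₀) ^ γ) atTop (𝓝 0) := by
    have h1 : Tendsto (fun n : ℕ => κ ^ n * ρ₀) atTop (𝓝 0) := by
      simpa using (tendsto_pow_atTop_nhds_zero_of_lt_one hκ0.le hκ1').mul_const ρ₀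
    have h2 : Tendsto (fun n : ℕ => (κ ^ n * ρ₀) ^ γ) atTop (𝓝 0) := by
      have := h1.rpow_const (p := γ) (Or.inr hγ0.le)
      rwa [Real.zero_rpow hγ0.ne'] at this
    simpa using h2.const_mul (Cκ * (M : ℝ) ^ (7 / 10 : ℝ))
  -- the recursions (13.48)–(13.49) at `z₀`
  have h48 : ∀ n : ℕ, alphaR u G τ₂ (κ ^ (n + 1) * ρ₀) z₀ ≤
      alphaR u G τ₂ (κ ^ n * ρ₀) z₀ / 4 +
      Cκ * betaR G (κ ^ n * ρ₀) z₀ ^ (1 / 2 : ℝ) * alphaR u G τ₂ (κ ^ n * ρ₀) z₀ +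
      Cκ * ((κ ^ n * ρ₀) ^ c * pR p q₀ τ₂ (κ ^ n * ρ₀) z₀) ^ (1 / q₀) *
        alphaR u G τ₂ (κ ^ n * ρ₀) z₀ ^ (1 / 2 : ℝ) +
      Cκ * (M : ℝ) ^ (7 / 10 : ℝ) * (κ ^ n * ρ₀) ^ γ * alphaR u G τ₂ (κ ^ n * ρ₀) z₀ ^ (1 / 2 : ℝ) := by
    intro n
    have := (hrec z₀ hz₀mem (κ ^ n * ρ₀) (hρn0 n) ((hρnle n).trans hρ₀r₀)).1
    rwa [hρnsucc n] at this
  have h49 : ∀ n : ℕ, (κ ^ (n + 1) * ρ₀) ^ c * pR p q₀ τ₂ (κ ^ (n + 1) * ρ₀) z₀ ≤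
      (κ ^ n * ρ₀) ^ c * pR p q₀ τ₂ (κ ^ n * ρ₀) z₀ / 4 +
      Cκ * betaR G (κ ^ n * ρ₀) z₀ ^ (q₀ / 2) * alphaR u G τ₂ (κ ^ n * ρ₀) z₀ ^ (q₀ / 2) := by
    intro n
    have := (hrec z₀ hz₀mem (κ ^ n * ρ₀) (hρn0 n) ((hρnle n).trans hρ₀r₀)).2.1
    rw [hρnsucc n] at this
    linarith
  obtain ⟨hαlim, hqlim⟩ := hiter (fun n => alphaR u G τ₂ (κ ^ n * ρ₀) z₀)
    (fun n => (κ ^ n * ρ₀) ^ c * pR p q₀ τ₂ (κ ^ n * ρ₀) z₀)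
    (fun n => Cκ * betaR G (κ ^ n * ρ₀) z₀ ^ (1 / 2 : ℝ))
    (fun n => Cκ * (M : ℝ) ^ (7 / 10 : ℝ) * (κ ^ n * ρ₀) ^ γ)
    (fun n => Cκ * betaR G (κ ^ n * ρ₀) z₀ ^ (q₀ / 2))
    (fun n => alphaR_nonneg u G τ₂ (hρn0 n).le z₀)
    (fun n => mul_nonneg (Real.rpow_nonneg (hρn0 n).le _) (pR_nonneg p q₀ τ₂ (hρn0 n).le z₀))
    (fun n => mul_nonneg hCκpos.le (Real.rpow_nonneg (hβn0 n) _))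
    (fun n => mul_nonneg (mul_nonneg hCκpos.le (Real.rpow_nonneg M.coe_nonneg _))
      (Real.rpow_nonneg (hρn0 n).le _))
    (fun n => mul_nonneg hCκpos.le (Real.rpow_nonneg (hβn0 n) _))
    h48 h49 (Eventually.of_forall hun) (Eventually.of_forall hwn) hvn
  ---------------------------------------------------------------------------------------------
  -- Stage 2: one scale `ρ_N = κ^N ρ₀` where `α ≤ 1/8`, `q ≤ c_*/16` at `z₀`; `r₁ = ρ_N / 2`
  ---------------------------------------------------------------------------------------------
  obtain ⟨N, hN1, hN2⟩ := ((hαlim.eventually (gt_mem_nhds (by norm_num : (0:ℝ) < 1 / 8))).and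
    (hqlim.eventually (gt_mem_nhds (by positivity : (0:ℝ) < cstar / 16)))).exists
  set r₁ : ℝ := κ ^ N * ρ₀ / 2 with hr₁def
  have hr₁ : 0 < r₁ := by positivity
  have h2r₁ : 2 * r₁ = κ ^ N * ρ₀ := by rw [hr₁def]; ring
  have hr₁ρ₀ : r₁ ≤ ρ₀ / 2 := by
    rw [hr₁def]; linarith [hρnle N]
  have hr₁r₀ : r₁ ≤ r₀ := by linarith
  have hr₁1 : r₁ ≤ ρ₁ := by linarith
  have hr₁2 : r₁ ≤ ρ₂ := by linarith
  have hr₁3 : r₁ ≤ ρ₃ := by linarith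
  have hQ₁r₀ : FluidPDE.parabolicCylinderCentered r₁ z₀ ⊆ FluidPDE.parabolicCylinderCentered r₀ z₀ :=
    FluidPDE.parabolicCylinderCentered_mono hr₁.le hr₁r₀ z₀
  have hQ₁Ω : FluidPDE.parabolicCylinderCentered r₁ z₀ ⊆ (Ω : Set (ℝ × ℝ³)) :=
    (hQ₁r₀.trans (cylinder_subset_room hz₀mem hr₀.le (by linarith))).trans hroom
  obtain ⟨hUN, hVN, hPN⟩ := hfin z₀ hz₀mem (κ ^ N * ρ₀) (hρn0 N) ((hρnle N).trans hρ₀r₀)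
  -- the pressure bound carried down the scales
  set Pstar : ℝ := (2 : ℝ) ^ b * pR p q₀ τ₂ (κ ^ N * ρ₀) z₀ + 4 / 3 * Cκ with hPstar
  have hPstar0 : 0 ≤ Pstar :=
    add_nonneg (mul_nonneg (Real.rpow_nonneg (by norm_num) _) (pR_nonneg p q₀ τ₂ (hρn0 N).le z₀))
      (by positivity)
  ---------------------------------------------------------------------------------------------
  -- Stage 3: at every `z ∈ Q_{r₁}(z₀)`, `α ≤ 1`, `q ≤ c_*`, `p ≤ P*` down the scales `κⁿ r₁`
  ---------------------------------------------------------------------------------------------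
  have hσ0 : ∀ n : ℕ, 0 < κ ^ n * r₁ := fun n => by positivity
  have hσle : ∀ n : ℕ, κ ^ n * r₁ ≤ r₁ := fun n =>
    mul_le_of_le_one_left hr₁.le (pow_le_one₀ hκ0.le hκ1)
  have hσsucc : ∀ n : ℕ, κ * (κ ^ n * r₁) = κ ^ (n + 1) * r₁ := fun n => by ring
  have stage3 : ∀ z ∈ FluidPDE.parabolicCylinderCentered r₁ z₀, ∀ n : ℕ,
      alphaR u G τ₂ (κ ^ n * r₁) z ≤ 1 ∧ pR p q₀ τ₂ (κ ^ n * r₁) z ≤ Pstar := by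
    intro z hz n
    have hzr₀ : z ∈ FluidPDE.parabolicCylinderCentered r₀ z₀ := hQ₁r₀ hz
    -- starting values at scale `r₁`
    have hstartα : alphaR u G τ₂ r₁ z ≤ 1 := by
      have h1 := alphaR_le_double (τ₂ := τ₂) hz (by rwa [h2r₁]) (by rwa [h2r₁])
      rw [h2r₁] at h1
      have h2 : (2 : ℝ) ^ (3 - 10 / τ₂) ≤ 8 := by
        calc (2 : ℝ) ^ (3 - 10 / τ₂) ≤ 2 ^ (3 : ℝ) :=
              Real.rpow_le_rpow_of_exponent_le (by norm_num) (by linarith)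
          _ = 8 := by norm_num
      have h3 : 0 ≤ alphaR u G τ₂ (κ ^ N * ρ₀) z₀ := alphaR_nonneg u G τ₂ (hρn0 N).le z₀
      nlinarith
    have hstartq : r₁ ^ c * pR p q₀ τ₂ r₁ z ≤ cstar := by
      have h1 := rpow_mul_pR_le_double (q₀ := q₀) (τ₂ := τ₂) (c := c) hz (by rwa [h2r₁])
      rw [h2r₁] at h1
      have h2 : (2 : ℝ) ^ (5 * (1 - 2 * q₀ / τ₂) - c) ≤ 16 := by
        calc (2 : ℝ) ^ (5 * (1 - 2 * q₀ / τ₂) - c) ≤ 2 ^ (4 : ℝ) :=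
              Real.rpow_le_rpow_of_exponent_le (by norm_num) hbc4
          _ = 16 := by norm_num
      have h3 : 0 ≤ (κ ^ N * ρ₀) ^ c * pR p q₀ τ₂ (κ ^ N * ρ₀) z₀ :=
        mul_nonneg (Real.rpow_nonneg (hρn0 N).le _) (pR_nonneg p q₀ τ₂ (hρn0 N).le z₀)
      nlinarith
    have hstartp : pR p q₀ τ₂ r₁ z ≤ (2 : ℝ) ^ b * pR p q₀ τ₂ (κ ^ N * ρ₀) z₀ := by
      have h1 := pR_le_double (q₀ := q₀) (τ₂ := τ₂) hz (by rwa [h2r₁])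
      rwa [h2r₁] at h1
    -- the β-free recursions along `κⁿ r₁` at the centre `z`
    have hβfree : ∀ n : ℕ,
        (alphaR u G τ₂ (κ ^ (n + 1) * r₁) z ≤ alphaR u G τ₂ (κ ^ n * r₁) z / 4 +
          Cκ * (κ ^ n * r₁) ^ (1 - 5 / τ₂) * alphaR u G τ₂ (κ ^ n * r₁) z ^ (3 / 2 : ℝ) +
          Cκ * ((κ ^ n * r₁) ^ c * pR p q₀ τ₂ (κ ^ n * r₁) z) ^ (1 / q₀) *
            alphaR u G τ₂ (κ ^ n * r₁) z ^ (1 / 2 : ℝ) +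
          Cκ * (M : ℝ) ^ (7 / 10 : ℝ) * (κ ^ n * r₁) ^ γ * alphaR u G τ₂ (κ ^ n * r₁) z ^ (1 / 2 : ℝ)) ∧
        ((κ ^ (n + 1) * r₁) ^ c * pR p q₀ τ₂ (κ ^ (n + 1) * r₁) z ≤
          (κ ^ n * r₁) ^ c * pR p q₀ τ₂ (κ ^ n * r₁) z / 4 +
          Cκ * (κ ^ n * r₁) ^ (q₀ * (1 - 5 / τ₂)) * alphaR u G τ₂ (κ ^ n * r₁) z ^ q₀) ∧
        (pR p q₀ τ₂ (κ ^ (n + 1) * r₁) z ≤ pR p q₀ τ₂ (κ ^ n * r₁) z / 4 +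
          Cκ * alphaR u G τ₂ (κ ^ n * r₁) z ^ q₀) := by
      intro n
      obtain ⟨h40, h41, h44⟩ := hrec z hzr₀ (κ ^ n * r₁) (hσ0 n) ((hσle n).trans hr₁r₀)
      rw [hσsucc n] at h40 h41 h44
      exact beta_free hCκpos.le (hσ0 n)
        (alphaR_nonneg u G τ₂ (hσ0 n).le z) (betaR_nonneg G (hσ0 n).le z) hq₀0 hτ₂0.ne'
        (betaR_le_alphaR u G τ₂ (hσ0 n) z) h40 h41 h44
    have hinv := invariant_region (q₀ := q₀) (Cκ := Cκ) (A₁ := Cκ) (A₂ := Cκ * (M : ℝ) ^ (7 / 10 : ℝ))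
      (A₃ := Cκ) (e₁ := 1 - 5 / τ₂) (e₂ := c) (γ := γ) (m := q₀) (ρ₀ := r₁)
      (ρ := fun n => κ ^ n * r₁) (α := fun n => alphaR u G τ₂ (κ ^ n * r₁) z)
      (q := fun n => (κ ^ n * r₁) ^ c * pR p q₀ τ₂ (κ ^ n * r₁) z)
      (p := fun n => pR p q₀ τ₂ (κ ^ n * r₁) z)
      hq₀0 hCκpos.le hCκpos.le (mul_nonneg hCκpos.le (Real.rpow_nonneg M.coe_nonneg _)) hCκpos.le
      he1.le hc0.le hγ0.le hq₀0 (hth1 r₁ hr₁ hr₁1) (hth2 r₁ hr₁ hr₁2) (hth3 r₁ hr₁ hr₁3)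
      hσ0 hσle (fun n => alphaR_nonneg u G τ₂ (hσ0 n).le z)
      (fun n => mul_nonneg (Real.rpow_nonneg (hσ0 n).le _) (pR_nonneg p q₀ τ₂ (hσ0 n).le z))
      (fun n => pR_nonneg p q₀ τ₂ (hσ0 n).le z)
      (fun n => (hβfree n).1) (fun n => (hβfree n).2.1) (fun n => (hβfree n).2.2)
      (by simpa using hstartα) (by simpa using hstartq) n
    obtain ⟨hαn, -, hpn⟩ := hinv
    refine ⟨hαn, ?_⟩
    calc pR p q₀ τ₂ (κ ^ n * r₁) z ≤ pR p q₀ τ₂ (κ ^ 0 * r₁) z + 4 / 3 * Cκ := hpn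
      _ ≤ (2 : ℝ) ^ b * pR p q₀ τ₂ (κ ^ N * ρ₀) z₀ + 4 / 3 * Cκ := by
          simp only [pow_zero, one_mul]
          linarith [hstartp]
  ---------------------------------------------------------------------------------------------
  -- Stage 4: the three Morrey conditions on `Q₂ = Q_{r₁}(z₀)`
  ---------------------------------------------------------------------------------------------
  have hfin₁ : ∀ z ∈ FluidPDE.parabolicCylinderCentered r₁ z₀, ∀ n : ℕ,
      energyU u (κ ^ n * r₁) z ≠ ∞ ∧ gradV G (κ ^ n * r₁) z ≠ ∞ ∧ pressureP p q₀ (κ ^ n * r₁) z ≠ ∞ :=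
    fun z hz n => hfin z (hQ₁r₀ hz) _ (hσ0 n) ((hσle n).trans hr₁r₀)
  -- velocity
  have hMu : IsParabolicMorreyOn (FluidPDE.parabolicCylinderCentered r₁ z₀)
      (fun w => ‖u w.1 w.2‖ₑ) 3 τ₂ := by
    have hloc : ∀ z ∈ FluidPDE.parabolicCylinderCentered r₁ z₀, ∀ n : ℕ,
        ∫⁻ w in FluidPDE.parabolicCylinderCentered (κ ^ n * r₁) z, (fun w => ‖u w.1 w.2‖ₑ) w ^ (3 : ℝ) ≤
          CW * ENNReal.ofReal ((κ ^ n * r₁) ^ (5 * (1 - 3 / τ₂))) := by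
      intro z hz n
      obtain ⟨hU, hV, -⟩ := hfin₁ z hz n
      have hroom₂ : FluidPDE.parabolicCylinderCentered (2 * (κ ^ n * r₁)) z ⊆ (Ω : Set (ℝ × ℝ³)) :=
        (cylinder_subset_room (hQ₁r₀ hz) (by positivity) (by linarith [hσle n])).trans hroom
      have hG := hS.hasWeakSpatialGradientOn.mono
        (show FluidPDE.parabolicCylinderCenteredOpens (2 * (κ ^ n * r₁)) z ≤ Ω from hroom₂)
      exact cubicW_le_of_alphaR_le_one hCW (hσ0 n) hG hU hV (stage3 z hz n).1
    have htot := hloc z₀ (self_mem_parabolicCylinderCentered hr₁ z₀) 0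
    simp only [pow_zero, one_mul] at htot
    have he : (0 : ℝ) ≤ 5 * (1 - 3 / τ₂) := by
      have : 3 / τ₂ ≤ 1 := by rw [div_le_one hτ₂0]; linarith
      exact mul_nonneg (by norm_num) (sub_nonneg.2 this)
    exact isParabolicMorreyOn_cylinder_of_discrete hr₁ hκ0 hκ1' he ENNReal.coe_ne_top
      (ENNReal.mul_ne_top ENNReal.coe_ne_top ENNReal.ofReal_ne_top) htot hloc
  -- pressure
  have hMp : IsParabolicMorreyOn (FluidPDE.parabolicCylinderCentered r₁ z₀)
      (fun w => ‖p w.1 w.2‖ₑ) q₀ (τ₂ / 2) := by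
    have hloc : ∀ z ∈ FluidPDE.parabolicCylinderCentered r₁ z₀, ∀ n : ℕ,
        ∫⁻ w in FluidPDE.parabolicCylinderCentered (κ ^ n * r₁) z, (fun w => ‖p w.1 w.2‖ₑ) w ^ q₀ ≤
          ENNReal.ofReal Pstar * ENNReal.ofReal ((κ ^ n * r₁) ^ (5 * (1 - q₀ / (τ₂ / 2)))) := by
      intro z hz n
      obtain ⟨-, -, hP⟩ := hfin₁ z hz n
      exact pressureP_le_of_pR_le (hσ0 n) hP hPstar0 (stage3 z hz n).2
    have htot := hloc z₀ (self_mem_parabolicCylinderCentered hr₁ z₀) 0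
    simp only [pow_zero, one_mul] at htot
    have he : (0 : ℝ) ≤ 5 * (1 - q₀ / (τ₂ / 2)) := by
      have : q₀ / (τ₂ / 2) ≤ 1 := by rw [div_le_one (by positivity)]; linarith
      exact mul_nonneg (by norm_num) (sub_nonneg.2 this)
    exact isParabolicMorreyOn_cylinder_of_discrete hr₁ hκ0 hκ1' he
      ENNReal.ofReal_ne_top (ENNReal.mul_ne_top ENNReal.ofReal_ne_top ENNReal.ofReal_ne_top) htot hloc
  -- gradient
  have hMG : IsParabolicMorreyOn (FluidPDE.parabolicCylinderCentered r₁ z₀)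
      (gradENorm G) 2 (τ₂⁻¹ + 5⁻¹)⁻¹ := by
    have hloc : ∀ z ∈ FluidPDE.parabolicCylinderCentered r₁ z₀, ∀ n : ℕ,
        ∫⁻ w in FluidPDE.parabolicCylinderCentered (κ ^ n * r₁) z, gradENorm G w ^ (2 : ℝ) ≤
          1 * ENNReal.ofReal ((κ ^ n * r₁) ^ (5 * (1 - 2 / (τ₂⁻¹ + 5⁻¹)⁻¹))) := by
      intro z hz n
      obtain ⟨hU, hV, -⟩ := hfin₁ z hz n
      exact lintegral_gradENorm_le_of_alphaR_le_one hτ₂0.ne' (hσ0 n) hU hV (stage3 z hz n).1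
    have htot := hloc z₀ (self_mem_parabolicCylinderCentered hr₁ z₀) 0
    simp only [pow_zero, one_mul] at htot
    have hexp : 5 * (1 - 2 / (τ₂⁻¹ + 5⁻¹)⁻¹) = 3 - 10 / τ₂ := by
      field_simp
      ring
    exact isParabolicMorreyOn_cylinder_of_discrete hr₁ hκ0 hκ1'
      (by rw [hexp]; linarith) ENNReal.one_ne_top ENNReal.ofReal_ne_top htot hloc
  exact ⟨r₁, hr₁, hQ₁Ω, hMu, hMp, hMG⟩

/-- **The current trust base of Thm. 13.8 (with `ε* = ε*(ν, τ₀, q₀)`) in one statement**: the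
criterion `lemarieRieusset_ckn_criterion_qdep` follows from the pressure localisation (13.20),
Lemma 13.3 (the local energy/pressure estimates), the interpolation inequality of
Robinson–Rodrigo–Sadowski (Lemma 15.10), Lemma 13.5 and Lemma 13.6 — Lemma 13.4 being now a
theorem (`lemma13_4_of`). [cite: LemarieRieusset2016, §13.9 pp. 466–477] -/
theorem lemarieRieusset_ckn_criterion_qdep_of_lemma13_3 (hP : pressure_localIntegrability)
    (h3 : lemma13_3) (hI : interpolationEstimate) (h5 : lemma13_5) (h6 : lemma13_6) :
    lemarieRieusset_ckn_criterion_qdep :=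
  lemarieRieusset_ckn_criterion_qdep_of_lemmas hP (lemma13_4_of h3 hI) h5 h6

end LemarieRieusset2016

end Literature.Analysis.FluidPDE
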